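import Literature.NumberTheory.Automorphic.SchwartzBruhatL2Norm
import Mathlib.MeasureTheory.Function.L2Space
import Mathlib.MeasureTheory.Function.SimpleFuncDenseLp
import Mathlib.MeasureTheory.Measure.Regular
import Mathlib.Topology.Separation.Profinite
import HarnessLib

/-!
# Schwartz–Bruhat functions are DENSE in `L²`: the embedding `𝒮(X) → L²(X, ν)`

Topic `NumberTheory/Automorphic`; namespace `Literature.NumberTheory.Automorphic.SchwartzBruhat` (that of the tree's
`SchwartzBruhat`, `TateLocalFactors.lean`, and of `SchwartzBruhatL2Norm.lean`).  KERNEL ONLY: one definition with body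
(`toLp`) and proved theorems; no named fact, no record, no `sorry`.

[Weil1964, Chap. I n° 11] works with the unitary operators of the metaplectic group on `L²(X)` and observes that the
Schwartz–Bruhat space `𝒮(X)` is a dense subspace stable under them; the smooth (Schwartz–Bruhat) models of the tree
(`SchrodingerModel`, `LocalUnitarySplittingDatum`, …) and the `L²` models (`SchrodingerSystem`, `StoneVonNeumann*`) have so
far not been connected.  This file supplies the connection at the level of the underlying spaces:

* §1 `SchwartzBruhat.memLp` — a Schwartz–Bruhat function (locally constant, compact support) is in every `ℒᵖ(ν)` for `ν`
  finite on compact sets; the LINEAR map **`SchwartzBruhat.toLp ν : 𝒮(X) →ₗ[ℂ] Lp ℂ 2 ν`**, `coeFn_toLp` (`toLp Φ = Φ` a.e.);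
* §2 the norm: `eLpNorm_coe_eq` / **`enorm_toLp_sq`** (`‖toLp Φ‖ₑ² = l2NormSq ν Φ = ∫⁻ |Φ|²`), `norm_toLp_sq`,
  `norm_toLp_eq_of_l2NormSq_eq`, and **`toLp_injective`** when `ν` charges non-empty open sets (`l2NormSq_pos`);
* §3 topology of locally compact Hausdorff totally disconnected spaces: **`exists_isCompact_isOpen_between`** — between a
  compact `K` and an open `U ⊇ K` there is a COMPACT OPEN set (the clopen basis `loc_compact_Haus_tot_disc_of_zero_dim` +
  local compactness); this is what replaces Urysohn functions in the totally disconnected world;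
* §4 **`exists_mem_eLpNorm_sub_le`** and **`denseRange_toLp`**: for `X` locally compact Hausdorff totally disconnected with
  its Borel σ-algebra and `ν` outer regular and inner regular for finite-measure sets with respect to compact sets
  (e.g. any Haar measure on a second countable locally compact totally disconnected group, any `ν.Regular`), every
  `f ∈ ℒ²(ν)` is approximated in `ℒ²`-seminorm by Schwartz–Bruhat functions, i.e. `toLp ν` has DENSE RANGE.  Proof:
  Mathlib's `MemLp.induction_dense` reduces to indicators `1_s c` of finite-measure measurable sets; inner/outer
  regularity give compact `K ⊆ s ⊆ U` open with `ν(U ∖ K)` small, §3 gives a compact open `V` with `K ⊆ V ⊆ U`, and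
  `1_V c ∈ 𝒮(X)` with `‖1_V c − 1_s c‖₂ ≤ ‖1_{V∖K} c‖₂ + ‖1_{s∖K} c‖₂` small (`exists_eLpNorm_indicator_le`).

Use (Track 2 of the Hodge/COR-CM cell's [GelbartRogawski1991, Prop. 3.1.1] citation, whose printed setting is the UNITARY
representation `ω_ψ` on the Hilbert space of `ρ_ψ`): with `SchwartzBruhatL2Norm.lean` (`IsL2Isometric`) this lets the tree's
`L²`-isometric Weil operators on `𝒮(F_vᴺ)` extend to unitary operators of `L²(F_vᴺ)` (`SchwartzBruhatL2UnitaryExtension.lean`).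
Nothing of [Weil1964] or [GelbartRogawski1991] is asserted here.

## References
* [Weil1964] A. Weil, *Sur certains groupes d'opérateurs unitaires*, Acta Math. 111 (1964) 143–211, Chap. I n° 11
  (Schwartz–Bruhat functions as a dense subspace of `L²(X)`).
* [Bruhat1961] F. Bruhat, *Distributions sur un groupe localement compact …*, Bull. SMF 89 (1961) 43–75, §9
  (locally constant compactly supported functions on totally disconnected groups).
* [BushnellHenniart2006] C. J. Bushnell, G. Henniart, *The local Langlands conjecture for GL(2)*, §23.1.
-/

set_option autoImplicit false

noncomputable section

open _root_.MeasureTheory _root_.MeasureTheory.Measure Set _root_.TopologicalSpace _root_.Filter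
open scoped ENNReal NNReal Topology

namespace Literature.NumberTheory.Automorphic

namespace SchwartzBruhat

variable {X : Type*} [TopologicalSpace X] [MeasurableSpace X] (ν : Measure X)

/-! ## §1 `𝒮(X) ⊆ ℒᵖ(ν)` and the linear map `toLp` -/

omit [MeasurableSpace X] in
/-- a Schwartz–Bruhat function is continuous (it is locally constant). [cite: Bruhat1961, §9] -/
theorem continuous_coe (Φ : SchwartzBruhat X) : Continuous (Φ : X → ℂ) := Φ.2.1.continuous

omit [MeasurableSpace X] in
/-- a Schwartz–Bruhat function has compact support. [cite: Bruhat1961, §9] -/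
theorem hasCompactSupport_coe (Φ : SchwartzBruhat X) : HasCompactSupport (Φ : X → ℂ) := Φ.2.2

section MemLp

variable [OpensMeasurableSpace X]

/-- a Schwartz–Bruhat function is a.e.-strongly measurable. [cite: Weil1964, Chap. I n° 11] -/
theorem aestronglyMeasurable (Φ : SchwartzBruhat X) : AEStronglyMeasurable (Φ : X → ℂ) ν :=
  (continuous_coe Φ).aestronglyMeasurable

omit [OpensMeasurableSpace X] in
/-- the `ℒ²` seminorm of (the function underlying) a Schwartz–Bruhat function: `‖Φ‖_{ℒ²} = (∫⁻ |Φ|²)^{1/2}`.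
[cite: Weil1964, Chap. I n° 11] -/
theorem eLpNorm_coe_eq (Φ : SchwartzBruhat X) :
    eLpNorm (Φ : X → ℂ) 2 ν = l2NormSq ν Φ ^ (1 / 2 : ℝ) := by
  rw [eLpNorm_eq_lintegral_rpow_enorm_toReal two_ne_zero ENNReal.ofNat_ne_top, ENNReal.toReal_ofNat, l2NormSq_def]
  congr 1
  refine lintegral_congr fun x => ?_
  rw [← ENNReal.rpow_natCast]
  norm_num

variable [IsFiniteMeasureOnCompacts ν]

/-- **`𝒮(X) ⊆ ℒᵖ(X, ν)`** for every exponent `p`, as soon as `ν` is finite on compact sets: a Schwartz–Bruhat function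
is continuous with compact support. [cite: Weil1964, Chap. I n° 11] -/
theorem memLp (Φ : SchwartzBruhat X) (p : ℝ≥0∞) : MemLp (Φ : X → ℂ) p ν :=
  (continuous_coe Φ).memLp_of_hasCompactSupport (hasCompactSupport_coe Φ)

/-- **the embedding `𝒮(X) → L²(X, ν)`**, `Φ ↦ [Φ]`, as a `ℂ`-linear map. [cite: Weil1964, Chap. I n° 11] -/
def toLp : SchwartzBruhat X →ₗ[ℂ] Lp ℂ 2 ν where
  toFun Φ := (memLp ν Φ 2).toLp (Φ : X → ℂ)
  map_add' Φ Ψ := by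
    rw [← MemLp.toLp_add (memLp ν Φ 2) (memLp ν Ψ 2)]
    rfl
  map_smul' c Φ := by
    rw [RingHom.id_apply, ← MemLp.toLp_const_smul c (memLp ν Φ 2)]
    rfl

/-- unfolding. [cite: Weil1964, Chap. I n° 11] -/
theorem toLp_apply (Φ : SchwartzBruhat X) : toLp ν Φ = (memLp ν Φ 2).toLp (Φ : X → ℂ) := rfl

/-- `toLp Φ = Φ` almost everywhere. [cite: Weil1964, Chap. I n° 11] -/
theorem coeFn_toLp (Φ : SchwartzBruhat X) : (toLp ν Φ : X → ℂ) =ᵐ[ν] (Φ : X → ℂ) :=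
  MemLp.coeFn_toLp (memLp ν Φ 2)

/-! ## §2 The `L²` norm of `toLp Φ` is `l2NormSq ν Φ` -/

/-- `‖toLp Φ‖_{L²}` as an extended real: `eLpNorm (toLp Φ) = (l2NormSq ν Φ)^{1/2}`. [cite: Weil1964, Chap. I n° 11] -/
theorem eLpNorm_toLp (Φ : SchwartzBruhat X) :
    eLpNorm (toLp ν Φ : X → ℂ) 2 ν = l2NormSq ν Φ ^ (1 / 2 : ℝ) := by
  rw [eLpNorm_congr_ae (coeFn_toLp ν Φ), eLpNorm_coe_eq]

/-- **`‖toLp Φ‖ₑ² = ∫⁻ |Φ|² = l2NormSq ν Φ`**. [cite: Weil1964, Chap. I n° 11] -/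
theorem enorm_toLp_sq (Φ : SchwartzBruhat X) : ‖toLp ν Φ‖ₑ ^ 2 = l2NormSq ν Φ := by
  rw [Lp.enorm_def, eLpNorm_toLp, ← ENNReal.rpow_natCast, ← ENNReal.rpow_mul]
  norm_num

/-- `‖toLp Φ‖ₑ = (l2NormSq ν Φ)^{1/2}`. [cite: Weil1964, Chap. I n° 11] -/
theorem enorm_toLp (Φ : SchwartzBruhat X) : ‖toLp ν Φ‖ₑ = l2NormSq ν Φ ^ (1 / 2 : ℝ) := by
  rw [Lp.enorm_def, eLpNorm_toLp]

/-- the real norm: `‖toLp Φ‖² = (l2NormSq ν Φ).toReal`. [cite: Weil1964, Chap. I n° 11] -/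
theorem norm_toLp_sq (Φ : SchwartzBruhat X) : ‖toLp ν Φ‖ ^ 2 = (l2NormSq ν Φ).toReal := by
  rw [← enorm_toLp_sq, ← ofReal_norm, ← ENNReal.ofReal_pow (norm_nonneg _),
    ENNReal.toReal_ofReal (pow_nonneg (norm_nonneg _) 2)]

/-- two Schwartz–Bruhat functions with the same `l2NormSq` have images of the same norm in `L²` (the form in which an
`L²`-ISOMETRIC operator on `𝒮(X)` — `Representation.IsL2Isometric` — is seen to preserve the `L²` norm).
[cite: Weil1964, Chap. I n° 13] -/
theorem norm_toLp_eq_of_l2NormSq_eq {Φ Ψ : SchwartzBruhat X} (h : l2NormSq ν Φ = l2NormSq ν Ψ) :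
    ‖toLp ν Φ‖ = ‖toLp ν Ψ‖ := by
  rw [Lp.norm_def, Lp.norm_def, eLpNorm_toLp, eLpNorm_toLp, h]

/-- **injectivity**: if `ν` charges every non-empty open set, `toLp ν` is injective (a non-zero Schwartz–Bruhat function has
positive `L²` norm, `l2NormSq_pos`). [cite: Weil1964, Chap. I n° 11] -/
theorem toLp_injective [ν.IsOpenPosMeasure] : Function.Injective (toLp ν : SchwartzBruhat X → Lp ℂ 2 ν) := by
  intro Φ Ψ h
  have h0 : toLp ν (Φ - Ψ) = 0 := by rw [map_sub, h, sub_self]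
  by_contra hne
  have hpos : 0 < l2NormSq ν (Φ - Ψ) := l2NormSq_pos ν (sub_ne_zero.2 hne)
  have : ‖toLp ν (Φ - Ψ)‖ₑ ^ 2 = 0 := by rw [h0, enorm_zero, zero_pow two_ne_zero]
  rw [enorm_toLp_sq] at this
  exact hpos.ne' this

/-- `toLp Φ = 0 ↔ Φ = 0` (for `ν` charging non-empty open sets). [cite: Weil1964, Chap. I n° 11] -/
theorem toLp_eq_zero_iff [ν.IsOpenPosMeasure] (Φ : SchwartzBruhat X) : toLp ν Φ = 0 ↔ Φ = 0 := by
  constructor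
  · intro h
    exact toLp_injective ν (by rw [h, map_zero])
  · rintro rfl
    exact map_zero _

end MemLp

/-! ## §3 Compact open sets in a locally compact Hausdorff totally disconnected space -/

section Topology

variable [LocallyCompactSpace X] [T2Space X] [TotallyDisconnectedSpace X]

omit [MeasurableSpace X] in
/-- every point of an open set `U` of a locally compact Hausdorff totally disconnected space has a COMPACT OPEN
neighbourhood inside `U` (clopen basis + a compact neighbourhood). [cite: Bruhat1961, §9] -/
theorem exists_isCompact_isOpen_mem_subset {x : X} {U : Set X} (hU : IsOpen U) (hx : x ∈ U) :
    ∃ V : Set X, IsCompact V ∧ IsOpen V ∧ x ∈ V ∧ V ⊆ U := by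
  obtain ⟨L, hLc, hLx⟩ := WeaklyLocallyCompactSpace.exists_compact_mem_nhds x
  have hx' : x ∈ interior L ∩ U := ⟨mem_interior_iff_mem_nhds.2 hLx, hx⟩
  obtain ⟨C, hCclopen, hxC, hCsub⟩ :=
    (loc_compact_Haus_tot_disc_of_zero_dim (H := X)).exists_subset_of_mem_open hx' (isOpen_interior.inter hU)
  refine ⟨C, hLc.of_isClosed_subset hCclopen.1 (hCsub.trans (inter_subset_left.trans interior_subset)), hCclopen.2, hxC,
    hCsub.trans inter_subset_right⟩

omit [MeasurableSpace X] in
/-- **between a compact set and an open set containing it there is a COMPACT OPEN set** (locally compact Hausdorff totally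
disconnected spaces): `K ⊆ U`, `K` compact, `U` open ⇒ `∃ V` compact open, `K ⊆ V ⊆ U`.  The totally disconnected
substitute for Urysohn's lemma. [cite: Bruhat1961, §9] -/
theorem exists_isCompact_isOpen_between {K U : Set X} (hK : IsCompact K) (hU : IsOpen U) (hKU : K ⊆ U) :
    ∃ V : Set X, IsCompact V ∧ IsOpen V ∧ K ⊆ V ∧ V ⊆ U := by
  choose V hVc hVo hxV hVU using fun x : K => exists_isCompact_isOpen_mem_subset (X := X) hU (hKU x.2)
  obtain ⟨t, ht⟩ := hK.elim_finite_subcover V hVo fun x hx => mem_iUnion.2 ⟨⟨x, hx⟩, hxV ⟨x, hx⟩⟩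
  refine ⟨⋃ i ∈ t, V i, t.isCompact_biUnion fun i _ => hVc i, isOpen_biUnion fun i _ => hVo i, ht, ?_⟩
  exact iUnion₂_subset fun i _ => hVU i

omit [MeasurableSpace X] [LocallyCompactSpace X] [TotallyDisconnectedSpace X] in
/-- the indicator of a compact open set (times a constant) is a Schwartz–Bruhat function (pattern of the tree's
`indicator_const_mem_schwartzBruhat`, restated here over a Hausdorff space to keep this file's imports measure-theoretic).
[cite: Bruhat1961, §9] -/
theorem indicator_const_mem_of_isCompact_isOpen {V : Set X} (hVc : IsCompact V) (hVo : IsOpen V) (c : ℂ) :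
    V.indicator (fun _ => c) ∈ SchwartzBruhat X := by
  refine ⟨(IsLocallyConstant.iff_exists_open _).2 fun x => ?_,
    HasCompactSupport.intro' hVc hVc.isClosed fun x hx => Set.indicator_of_notMem hx _⟩
  by_cases hx : x ∈ V
  · exact ⟨V, hVo, hx, fun y hy => by rw [Set.indicator_of_mem hy, Set.indicator_of_mem hx]⟩
  · exact ⟨Vᶜ, hVc.isClosed.isOpen_compl, hx, fun y hy => by
      rw [Set.indicator_of_notMem (Set.notMem_of_mem_compl hy), Set.indicator_of_notMem hx]⟩

end Topology

/-! ## §4 Density of `𝒮(X)` in `L²(X, ν)` -/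

section Dense

variable [BorelSpace X] [LocallyCompactSpace X] [T2Space X] [TotallyDisconnectedSpace X]
  [ν.OuterRegular] [ν.InnerRegularCompactLTTop]

/-- the indicator step of the density argument: a scalar multiple `1_s c` of the indicator of a finite-measure measurable
set is `ℒᵖ`-approximated (`1 ≤ p < ∞`) by indicators `1_V c` of COMPACT OPEN sets `V` — inner regularity gives a compact
`K ⊆ s`, outer regularity an open `U ⊇ s`, §3 a compact open `V` in between, and `‖1_V c − 1_s c‖_p ≤ ‖1_{V∖K} c‖_p +
‖1_{s∖K} c‖_p`. [cite: Weil1964, Chap. I n° 11] -/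
theorem exists_indicator_isCompact_isOpen_eLpNorm_sub_le {p : ℝ≥0∞} (hp1 : 1 ≤ p) (hp : p ≠ ∞) (c : ℂ) {s : Set X}
    (hs : MeasurableSet s) (hμs : ν s < ∞) {ε : ℝ≥0∞} (hε : ε ≠ 0) :
    ∃ V : Set X, IsCompact V ∧ IsOpen V ∧
      eLpNorm (V.indicator (fun _ => c) - s.indicator fun _ => c) p ν ≤ ε := by
  have hε2 : ε / 2 ≠ 0 := (ENNReal.half_pos hε).ne'
  obtain ⟨η, hηpos, hη⟩ := exists_eLpNorm_indicator_le (μ := ν) hp c hε2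
  have hη2 : ((η : ℝ≥0∞) / 2) ≠ 0 := (ENNReal.half_pos (ENNReal.coe_pos.2 hηpos).ne').ne'
  -- inner regularity: a compact `K ⊆ s` with `ν (s \ K) < η/2`
  obtain ⟨K, hKs, hKc, hsK⟩ := hs.exists_isCompact_sdiff_lt hμs.ne hη2
  -- outer regularity: an open `U ⊇ s` with `ν (U \ s) < η/2`
  obtain ⟨U, hsU, hUo, -, hUs⟩ := hs.exists_isOpen_sdiff_lt hμs.ne hη2
  -- a compact open set in between
  obtain ⟨V, hVc, hVo, hKV, hVU⟩ := exists_isCompact_isOpen_between (X := X) hKc hUo (hKs.trans hsU)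
  refine ⟨V, hVc, hVo, ?_⟩
  have hKm : MeasurableSet K := hKc.measurableSet
  have hVm : MeasurableSet V := hVo.measurableSet
  -- the two small sets
  have h1 : ν (V \ K) ≤ η := by
    have hsub : V \ K ⊆ U \ s ∪ s \ K := by
      intro x hx
      by_cases hxs : x ∈ s
      · exact Or.inr ⟨hxs, hx.2⟩
      · exact Or.inl ⟨hVU hx.1, hxs⟩
    calc ν (V \ K) ≤ ν (U \ s ∪ s \ K) := measure_mono hsub
      _ ≤ ν (U \ s) + ν (s \ K) := measure_union_le _ _
      _ ≤ (η : ℝ≥0∞) / 2 + (η : ℝ≥0∞) / 2 := add_le_add hUs.le hsK.le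
      _ = η := ENNReal.add_halves _
  have h2 : ν (s \ K) ≤ η := hsK.le.trans (ENNReal.half_le_self)
  -- `1_V c - 1_s c = 1_{V \ K} c - 1_{s \ K} c`
  have hdec : (V.indicator (fun _ => c) - s.indicator fun _ => c) =
      (V \ K).indicator (fun _ => c) - (s \ K).indicator fun _ => c := by
    rw [Set.indicator_sdiff hKV, Set.indicator_sdiff hKs, sub_sub_sub_cancel_right]
  rw [hdec]
  calc eLpNorm ((V \ K).indicator (fun _ => c) - (s \ K).indicator fun _ => c) p ν
      ≤ eLpNorm ((V \ K).indicator fun _ => c) p ν + eLpNorm ((s \ K).indicator fun _ => c) p ν :=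
        eLpNorm_sub_le ((aestronglyMeasurable_const (b := c)).indicator (hVm.diff hKm))
          ((aestronglyMeasurable_const (b := c)).indicator (hs.diff hKm)) hp1
    _ ≤ ε / 2 + ε / 2 := add_le_add (hη _ h1) (hη _ h2)
    _ = ε := ENNReal.add_halves _

/-- **every `f ∈ ℒ²(ν)` is `ℒ²`-approximated by Schwartz–Bruhat functions** (`X` locally compact Hausdorff totally
disconnected with its Borel σ-algebra; `ν` outer regular, and inner regular for finite-measure sets with respect to
compact sets). [cite: Weil1964, Chap. I n° 11] -/
theorem exists_mem_eLpNorm_sub_le {f : X → ℂ} (hf : MemLp f 2 ν) {ε : ℝ≥0∞} (hε : ε ≠ 0) :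
    ∃ Φ : SchwartzBruhat X, eLpNorm (f - (Φ : X → ℂ)) 2 ν ≤ ε := by
  obtain ⟨g, hg, hgS⟩ := hf.induction_dense (ENNReal.ofNat_ne_top : (2 : ℝ≥0∞) ≠ ∞) (fun g : X → ℂ => g ∈ SchwartzBruhat X)
    (fun c s hs hμs ε hε => by
      obtain ⟨V, hVc, hVo, hV⟩ := exists_indicator_isCompact_isOpen_eLpNorm_sub_le ν one_le_two (ENNReal.ofNat_ne_top : (2 : ℝ≥0∞) ≠ ∞) c hs hμs hε
      exact ⟨V.indicator fun _ => c, hV, indicator_const_mem_of_isCompact_isOpen hVc hVo c⟩)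
    (fun f g hf hg => (SchwartzBruhat X).add_mem hf hg)
    (fun f hf => aestronglyMeasurable ν ⟨f, hf⟩) hε
  exact ⟨⟨g, hgS⟩, hg⟩

variable [IsFiniteMeasureOnCompacts ν]

/-- **`𝒮(X)` is DENSE in `L²(X, ν)`**: the linear map `toLp ν : 𝒮(X) → L²(X, ν)` has dense range.
[cite: Weil1964, Chap. I n° 11] -/
theorem denseRange_toLp : DenseRange (toLp ν : SchwartzBruhat X → Lp ℂ 2 ν) := by
  refine Metric.denseRange_iff.2 fun f r hr => ?_
  have hr2 : ENNReal.ofReal (r / 2) ≠ 0 := by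
    rw [Ne, ENNReal.ofReal_eq_zero, not_le]
    exact half_pos hr
  obtain ⟨Φ, hΦ⟩ := exists_mem_eLpNorm_sub_le ν (Lp.memLp f) hr2
  refine ⟨Φ, ?_⟩
  rw [dist_eq_norm, Lp.norm_def]
  have hae : eLpNorm ((f - toLp ν Φ : Lp ℂ 2 ν) : X → ℂ) 2 ν = eLpNorm ((f : X → ℂ) - (Φ : X → ℂ)) 2 ν :=
    eLpNorm_congr_ae ((Lp.coeFn_sub _ _).trans ((EventuallyEq.rfl).sub (coeFn_toLp ν Φ)))
  rw [hae]
  calc (eLpNorm ((f : X → ℂ) - (Φ : X → ℂ)) 2 ν).toReal ≤ (ENNReal.ofReal (r / 2)).toReal :=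
        ENNReal.toReal_mono ENNReal.ofReal_ne_top hΦ
    _ = r / 2 := ENNReal.toReal_ofReal (half_pos hr).le
    _ < r := half_lt_self hr

/-- the same, as density of the range as a set. [cite: Weil1964, Chap. I n° 11] -/
theorem dense_range_toLp : Dense (Set.range (toLp ν : SchwartzBruhat X → Lp ℂ 2 ν)) :=
  denseRange_toLp ν

/-- the closure of the image submodule `toLp(𝒮(X))` is all of `L²(X, ν)`. [cite: Weil1964, Chap. I n° 11] -/
theorem topologicalClosure_range_toLp : (LinearMap.range (toLp ν)).topologicalClosure = ⊤ := by
  rw [← Submodule.dense_iff_topologicalClosure_eq_top, LinearMap.coe_range]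
  exact dense_range_toLp ν

end Dense

end SchwartzBruhat

end Literature.NumberTheory.Automorphic

end
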